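import Literature.NumberTheory.CubicFields.PeriodicChainCellsGrid
import HarnessLib

/-!
# Cells of a periodic chain: few defects along an arithmetic progression

Topic `Literature/NumberTheory/CubicFields`; theorem-only sequel of `PeriodicChainCells.lean` / `PeriodicChainCellsGrid.lean`.
For the periodic chain `G` (period `n₀`, `R`) with sub-cell resolution `N`, the BREAKPOINTS are the `G k + m/N`,
`m/N < G (k+1) − G k`. Along an arithmetic progression `z_j = z₀ + jΔ` (`j < J`) with a tolerance `η`, `2η < Δ`, call `j`
DEFECTIVE when some breakpoint lies in `[z_j − η, z_j + Δ + η]` (then, and only then, the cell function may differ between two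
`η`-perturbed samples of `[z_j, z_j + Δ]`, `chain_cell_eq_of_no_breakpoint`):

* `card_nat_filter_Icc_le_two` — an interval of length `< 2` contains at most two naturals;
* `breakpoint_index_bounds` — a breakpoint in the window `[z₀ − η, z₀ − η + qR]` has index `k ∈ [idx (z₀−η), idx (z₀−η) + q n₀]`;
* `ap_defect_card_le` — **few defects**: if `JΔ + Δ + 2η ≤ qR` then at most `2 (N (qR + gmax) + q n₀ + 1)` indices `j < J`
  are defective (`gmax` a bound for the gaps): every breakpoint is met by at most two `j`, and the window holds at most
  `N (qR + gmax) + q n₀ + 1` breakpoints.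

This is the counting behind the defect density of the class-group table (Hallgren 2005, §4). Pure real-variable combinatorics.

## References

* S. Hallgren, *Fast quantum algorithms for computing the unit group and class group of a number field*, STOC 2005, §4.
* J. Buchmann, H. C. Williams, Math. Comp. 50 (1988), §3. [BuchmannWilliams1988Infrastructure]
-/

namespace Literature.NumberTheory.CubicFields

open Finset

section Count

/-- **At most two naturals in an interval of length `< 2`.** [folklore] -/
theorem card_nat_filter_Icc_le_two (J : ℕ) (u L : ℝ) (hL : L < 2) :
    ((Finset.range J).filter (fun j : ℕ => u ≤ (j : ℝ) ∧ (j : ℝ) ≤ u + L)).card ≤ 2 := by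
  by_contra hcon
  push Not at hcon
  obtain ⟨t, ht, hcard⟩ := Finset.exists_subset_card_eq
    (show 3 ≤ ((Finset.range J).filter (fun j : ℕ => u ≤ (j : ℝ) ∧ (j : ℝ) ≤ u + L)).card by omega)
  have hne : t.Nonempty := by rw [← Finset.card_pos]; omega
  have hmin := Finset.min'_mem t hne
  have hmax := Finset.max'_mem t hne
  have h3 : t.min' hne + 2 ≤ t.max' hne := by
    by_contra h'
    push Not at h'
    have hsub : t ⊆ Finset.Icc (t.min' hne) (t.min' hne + 1) := by
      intro x hx
      simp only [Finset.mem_Icc]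
      exact ⟨Finset.min'_le t x hx, by have := Finset.le_max' t x hx; omega⟩
    have := Finset.card_le_card hsub
    simp at this; omega
  have hmin' := ht hmin
  have hmax' := ht hmax
  simp only [Finset.mem_filter, Finset.mem_range] at hmin' hmax'
  have : ((t.min' hne : ℕ) : ℝ) + 2 ≤ (t.max' hne : ℕ) := by exact_mod_cast h3
  linarith [hmin'.2.1, hmax'.2.2]

end Count

section Defects

variable {G : ℤ → ℝ} (hG : StrictMono G) {n₀ : ℕ} (hn₀ : 0 < n₀) {R : ℝ} (hper : ∀ i, G (i + n₀) = G i + R)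
variable {idx : ℝ → ℤ} (hidx : ∀ x, G (idx x) ≤ x ∧ x < G (idx x + 1)) {N : ℝ} (hN : 0 < N)

include hG hper hidx hN in
/-- **Index range of the breakpoints of a window**: a breakpoint `G k + m/N` (`m/N < G (k+1) − G k`) lying in
`[w, w + qR]` has `idx w ≤ k ≤ idx w + q n₀`. [folklore] -/
theorem breakpoint_index_bounds (w : ℝ) (q : ℕ) {k : ℤ} {m : ℕ} (hm : (m : ℝ) / N < G (k + 1) - G k)
    (h1 : w ≤ G k + m / N) (h2 : G k + m / N ≤ w + q * R) : idx w ≤ k ∧ k ≤ idx w + q * n₀ := by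
  have hm0 : (0 : ℝ) ≤ m / N := by positivity
  have hw := hidx w
  constructor
  · by_contra hcon
    push Not at hcon
    have : G (k + 1) ≤ G (idx w) := hG.monotone (by omega)
    linarith
  · by_contra hcon
    push Not at hcon
    have hper' : G (idx w + 1 + q * n₀) = G (idx w + 1) + q * R := by
      exact_mod_cast chain_add_mul_period hper (idx w + 1) (q : ℤ)
    have : G (idx w + 1 + q * n₀) ≤ G k := hG.monotone (by omega)
    linarith

open scoped Classical in
include hG hn₀ hper hidx hN in
/-- **Few defects along an arithmetic progression.** With `Δ > 0`, `2η < Δ`, `JΔ + Δ + 2η ≤ qR` and gaps `≤ gmax`: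
the number of `j < J` such that some breakpoint lies in `[z₀ + jΔ − η, z₀ + jΔ + Δ + η]` is at most
`2 (N (qR + gmax) + q n₀ + 1)`. [cite: BuchmannWilliams1988Infrastructure, §3] -/
theorem ap_defect_card_le (z₀ : ℝ) {Δ η : ℝ} (hΔ : 0 < Δ) (h2η : 2 * η < Δ) (J q : ℕ)
    (hq : J * Δ + Δ + 2 * η ≤ q * R) {gmax : ℝ} (hgap : ∀ k, G (k + 1) - G k ≤ gmax) :
    ((((Finset.range J).filter (fun j : ℕ => ∃ (k : ℤ) (m : ℕ), (m : ℝ) / N < G (k + 1) - G k ∧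
        z₀ + j * Δ - η ≤ G k + m / N ∧ G k + m / N ≤ z₀ + j * Δ + Δ + η)).card : ℕ) : ℝ) ≤
      2 * (N * (q * R + gmax) + q * n₀ + 1) := by
  have hR : 0 < R := chain_period_pos hG hn₀ hper
  set w : ℝ := z₀ - η with hw
  set K₁ : ℤ := idx w with hK₁
  set c : ℕ → ℕ := fun j' => ⌈(G (K₁ + j' + 1) - G (K₁ + j')) * N⌉₊ with hc
  set hit : ℤ → ℕ → ℕ → Prop := fun k m j => z₀ + j * Δ - η ≤ G k + m / N ∧ G k + m / N ≤ z₀ + j * Δ + Δ + η with hhit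
  set BP : Finset (Σ _ : ℕ, ℕ) := (Finset.range (q * n₀ + 1)).sigma (fun j' => Finset.range (c j')) with hBP
  set D := (Finset.range J).filter (fun j : ℕ => ∃ (k : ℤ) (m : ℕ), (m : ℝ) / N < G (k + 1) - G k ∧
        z₀ + j * Δ - η ≤ G k + m / N ∧ G k + m / N ≤ z₀ + j * Δ + Δ + η) with hD
  -- every defective `j` is hit by a breakpoint of the window
  have hsub : D ⊆ BP.biUnion (fun p => (Finset.range J).filter (fun j => hit (K₁ + p.1) p.2 j)) := by
    intro j hj
    rw [hD, Finset.mem_filter, Finset.mem_range] at hj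
    obtain ⟨hjJ, k, m, hm, h1, h2⟩ := hj
    have hjR : (j : ℝ) * Δ + Δ + 2 * η ≤ q * R := by
      have : (j : ℝ) + 1 ≤ J := by exact_mod_cast hjJ
      nlinarith
    obtain ⟨hk1, hk2⟩ := breakpoint_index_bounds hG hper hidx hN w q hm (by rw [hw]; nlinarith)
      (by rw [hw]; linarith)
    obtain ⟨j', hj'⟩ : ∃ j' : ℕ, k = K₁ + j' := ⟨(k - K₁).toNat, by omega⟩
    rw [Finset.mem_biUnion]
    refine ⟨⟨j', m⟩, ?_, ?_⟩
    · simp only [hBP, Finset.mem_sigma, Finset.mem_range]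
      refine ⟨by omega, ?_⟩
      simp only [hc]
      have hm' : (m : ℝ) < (G (K₁ + j' + 1) - G (K₁ + j')) * N := by
        rw [← hj']; rwa [div_lt_iff₀ hN] at hm
      exact_mod_cast lt_of_lt_of_le hm' (Nat.le_ceil _)
    · rw [Finset.mem_filter, Finset.mem_range]
      exact ⟨hjJ, by rw [← hj']; exact h1, by rw [← hj']; exact h2⟩
  -- each breakpoint hits at most two `j`
  have htwo : ∀ p : Σ _ : ℕ, ℕ, ((Finset.range J).filter (fun j => hit (K₁ + p.1) p.2 j)).card ≤ 2 := by
    intro p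
    set bpt : ℝ := G (K₁ + p.1) + (p.2 : ℝ) / N with hbpt
    have heq : (Finset.range J).filter (fun j => hit (K₁ + p.1) p.2 j) =
        (Finset.range J).filter (fun j : ℕ => (bpt - Δ - η - z₀) / Δ ≤ (j : ℝ) ∧
          (j : ℝ) ≤ (bpt - Δ - η - z₀) / Δ + (Δ + 2 * η) / Δ) := by
      apply Finset.filter_congr
      intro j _
      rw [hhit]
      change (z₀ + j * Δ - η ≤ bpt ∧ bpt ≤ z₀ + j * Δ + Δ + η) ↔ _
      rw [← add_div, div_le_iff₀ hΔ, le_div_iff₀ hΔ]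
      constructor <;> rintro ⟨h1, h2⟩ <;> constructor <;> linarith
    rw [heq]
    refine card_nat_filter_Icc_le_two J _ _ ?_
    rw [div_lt_iff₀ hΔ]; linarith
  -- count the breakpoints of the window
  have hcardBP : (BP.card : ℝ) ≤ N * (q * R + gmax) + q * n₀ + 1 := by
    rw [hBP, Finset.card_sigma]
    have hcj : ∀ j', ((Finset.range (c j')).card : ℝ) ≤ (G (K₁ + j' + 1) - G (K₁ + j')) * N + 1 := fun j' => by
      rw [Finset.card_range, hc]
      have h0 : 0 ≤ (G (K₁ + j' + 1) - G (K₁ + j')) * N :=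
        mul_nonneg (by linarith [hG (show K₁ + j' < K₁ + j' + 1 by omega)]) hN.le
      exact (Nat.ceil_lt_add_one h0).le
    have htel : ∑ j' ∈ Finset.range (q * n₀ + 1), (G (K₁ + j' + 1) - G (K₁ + j')) =
        G (K₁ + ((q * n₀ : ℕ) : ℤ) + 1) - G K₁ := by
      have h := Finset.sum_range_sub (fun j' => G (K₁ + j')) (q * n₀ + 1)
      simp only [Nat.cast_add, Nat.cast_one, Nat.cast_zero, add_zero] at h
      rw [show K₁ + ((q * n₀ : ℕ) : ℤ) + 1 = K₁ + (((q * n₀ : ℕ) : ℤ) + 1) by ring, ← h]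
      exact Finset.sum_congr rfl fun j _ => by rw [add_assoc]
    have hend : G (K₁ + ((q * n₀ : ℕ) : ℤ) + 1) - G K₁ ≤ q * R + gmax := by
      have h1 : G (K₁ + 1 + q * n₀) = G (K₁ + 1) + q * R := by
        exact_mod_cast chain_add_mul_period hper (K₁ + 1) (q : ℤ)
      rw [show K₁ + ((q * n₀ : ℕ) : ℤ) + 1 = K₁ + 1 + q * n₀ by push_cast; ring, h1]
      linarith [hgap K₁]
    calc ((∑ j' ∈ Finset.range (q * n₀ + 1), (Finset.range (c j')).card : ℕ) : ℝ)
        ≤ ∑ j' ∈ Finset.range (q * n₀ + 1), ((G (K₁ + j' + 1) - G (K₁ + j')) * N + 1) := by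
          push_cast; exact Finset.sum_le_sum fun j' _ => hcj j'
      _ = (∑ j' ∈ Finset.range (q * n₀ + 1), (G (K₁ + j' + 1) - G (K₁ + j'))) * N + (q * n₀ + 1 : ℕ) := by
          rw [Finset.sum_add_distrib, Finset.sum_const, Finset.card_range, Finset.sum_mul]; simp
      _ ≤ (q * R + gmax) * N + (q * n₀ + 1 : ℕ) := by rw [htel]; nlinarith
      _ = N * (q * R + gmax) + q * n₀ + 1 := by push_cast; ring
  -- assemble
  have hcardD : (D.card : ℝ) ≤ 2 * BP.card := by
    have h := (Finset.card_le_card hsub).trans (Finset.card_biUnion_le)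
    have h2 : ∑ p ∈ BP, ((Finset.range J).filter (fun j => hit (K₁ + p.1) p.2 j)).card ≤ ∑ p ∈ BP, 2 :=
      Finset.sum_le_sum fun p _ => htwo p
    rw [Finset.sum_const, smul_eq_mul] at h2
    have : (D.card : ℝ) ≤ ((BP.card * 2 : ℕ) : ℝ) := by exact_mod_cast h.trans h2
    push_cast at this; linarith
  linarith

end Defects

section Summary

open scoped Classical in
/-- **Summary (registered helper of the class-group stage)**: few defects along an arithmetic progression through the cells
of a periodic chain. [cite: BuchmannWilliams1988Infrastructure, §3] -/
theorem periodicChain_ap_defect_card_le : ∀ (G : ℤ → ℝ), StrictMono G → ∀ (n₀ : ℕ), 0 < n₀ → ∀ (R : ℝ), (∀ i, G (i + n₀) = G i + R) → ∀ (idx : ℝ → ℤ), (∀ x, G (idx x) ≤ x ∧ x < G (idx x + 1)) → ∀ (N : ℝ), 0 < N → ∀ (z₀ Δ η : ℝ), 0 < Δ → 2 * η < Δ → ∀ (J q : ℕ), J * Δ + Δ + 2 * η ≤ q * R → ∀ (gmax : ℝ), (∀ k, G (k + 1) - G k ≤ gmax) → ((((Finset.range J).filter (fun j : ℕ => ∃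 (k : ℤ) (m : ℕ), (m : ℝ) / N < G (k + 1) - G k ∧ z₀ + j * Δ - η ≤ G k + m / N ∧ G k + m / N ≤ z₀ + j * Δ + Δ + η)).card : ℕ) : ℝ) ≤ 2 * (N * (q * R + gmax) + q * n₀ + 1) :=
  fun _ hG _ hn₀ _ hper _ hidx _ hN z₀ _ _ hΔ h2η J q hq _ hgap => ap_defect_card_le hG hn₀ hper hidx hN z₀ hΔ h2η J q hq hgap

end Summary


end Literature.NumberTheory.CubicFields
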